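import Mathlib.Topology.Homotopy.Contractible
import Mathlib.AlgebraicTopology.FundamentalGroupoid.SimplyConnected
import Literature.LinearAlgebra.QuadraticForm.PosComplexStructuresConnected
import HarnessLib

/-!
# `X⁺` is contractible

Topic `LinearAlgebra/QuadraticForm`, sequel of `QuadraticForm/PositiveProjectionsPathConnected`
and `QuadraticForm/PosComplexStructuresConnected`, which join any two points of Deligne's period
domain `X⁺ = posComplexStructures k ψ` ([Deligne1982HodgeCycles, proof of Thm. 4.8, p. 49]:
"an open connected complex submanifold of a product of Grassmannians"; it is the Hermitian
symmetric domain `U(n, n)/U(n) × U(n)`, a bounded symmetric domain, hence a cell) by the explicit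
GRAPH PATH `P_t = A_t G_t⁻¹ A_t†` of positive projections. That path is canonical — a formula in
`(P₀, P₁, t)` — so for fixed `P₀` it is a deformation retraction of the whole space onto the point
`P₀` as soon as it is JOINTLY continuous in `(t, P₁)`, which it is (`Ring.inverse` is continuous at
the units of the Banach algebra `End V`). Hence:

* `IsPosProjection.continuousAt_projPath₂` — joint continuity of `(t, P₁) ↦ P_t` at `t ∈ [0, 1]`,
  `P₁` a positive projection;
* `IsPosProjection.continuous_projPath_restrict`, `IsPosProjection.homotopyProjPathFun`,
  `IsPosProjection.homotopyProjPath`, `IsPosProjection.contractibleSpace_setOf` — the positive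
  projections of a symmetric form commuting with a given set `C` of operators form a CONTRACTIBLE
  space when non-empty (`C = ∅`: the symmetric space `O(p, q)/O(p) × O(q)`; `C = {i}`:
  `U(p, q)/U(p) × U(q)`);
* `homeomorphOfProj` — the affine dictionary `P ↦ J_P = i (2P - 1)`, `J ↦ P_J = ½ (1 - i J)` of
  `PosComplexStructuresConnected` as a homeomorphism onto `X⁺`;
* `contractibleSpace_posComplexStructures`, `simplyConnectedSpace_posComplexStructures` — `X⁺` is
  contractible, in particular simply connected (so that, with the covering map
  `X⁺ → Γ\X⁺` of `QuadraticForm/PosComplexStructuresArithmeticQuotient` for torsion-free `Γ`,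
  `X⁺` is the universal cover of the base `Γ\X⁺` of Deligne's family and local systems on `X⁺`
  are trivial — the input for "the monodromy of `Γ\B → Γ\X⁺` is `Γ`", p. 50).

Everything is proved, Mathlib only; the only definitions are the contracting homotopy and the
homeomorphism; no named facts.

## References

* [Deligne1982HodgeCycles] P. Deligne (notes by J. S. Milne), Hodge cycles on abelian varieties,
  LNM 900 (1982), proof of Thm. 4.8, pp. 48–50.
-/

noncomputable section

namespace Literature.LinearAlgebra.QuadraticForm

open Module Set unitInterval Topology

variable {V : Type*} [NormedAddCommGroup V] [NormedSpace ℝ V]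

namespace IsPosProjection

variable {S : LinearMap.BilinForm ℝ V} {P₀ P₁ : V →L[ℝ] V}

/-! ### Joint continuity of the graph path -/

/-- `(t, P) ↦ A_t = B_t P` is jointly continuous. [folklore] -/
theorem continuous_graphMap₂ (P₀ : V →L[ℝ] V) :
    Continuous fun q : ℝ × (V →L[ℝ] V) => graphMap P₀ q.2 q.1 := by
  unfold graphMap stretch
  fun_prop

/-- `(t, P) ↦ A_t† = P B_t` is jointly continuous. [folklore] -/
theorem continuous_graphMapAdj₂ (P₀ : V →L[ℝ] V) :
    Continuous fun q : ℝ × (V →L[ℝ] V) => graphMapAdj P₀ q.2 q.1 := by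
  unfold graphMapAdj stretch
  fun_prop

/-- `(t, P) ↦ G_t = P B_{t²} P + (1 - P)` is jointly continuous. [folklore] -/
theorem continuous_gramOp₂ (P₀ : V →L[ℝ] V) :
    Continuous fun q : ℝ × (V →L[ℝ] V) => gramOp P₀ q.2 q.1 := by
  unfold gramOp stretch
  fun_prop

/-- **Joint continuity of the graph path**: `(t, P₁) ↦ P_t = A_t G_t⁻¹ A_t†` is continuous at
every `(t, P₁)` with `t ∈ [0, 1]` and `P₁` a positive projection (there `G_t` is a unit, and
`Ring.inverse` is continuous at units of the Banach algebra `End V`). [folklore] -/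
theorem continuousAt_projPath₂ [FiniteDimensional ℝ V] (hP₀ : IsPosProjection S P₀)
    (hP₁ : IsPosProjection S P₁) (hS : S.IsSymm) {t : ℝ} (ht : t ∈ unitInterval) :
    ContinuousAt (fun q : ℝ × (V →L[ℝ] V) => projPath P₀ q.2 q.1) (t, P₁) := by
  have hunit := isUnit_gramOp hP₀ hP₁ hS ht
  have hinv : ContinuousAt (fun q : ℝ × (V →L[ℝ] V) => Ring.inverse (gramOp P₀ q.2 q.1))
      (t, P₁) := by
    have h1 : ContinuousAt Ring.inverse (gramOp P₀ P₁ t) := by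
      have h := NormedRing.inverse_continuousAt hunit.unit
      rwa [hunit.unit_spec] at h
    exact h1.comp_of_eq (continuous_gramOp₂ P₀).continuousAt rfl
  change ContinuousAt (fun q : ℝ × (V →L[ℝ] V) =>
    graphMap P₀ q.2 q.1 * Ring.inverse (gramOp P₀ q.2 q.1) * graphMapAdj P₀ q.2 q.1) (t, P₁)
  exact ((continuous_graphMap₂ P₀).continuousAt.mul hinv).mul
    (continuous_graphMapAdj₂ P₀).continuousAt

/-! ### Contractibility of the space of positive projections -/

section Main

variable [FiniteDimensional ℝ V]

/-- The graph path restricted to `[0, 1] × {positive projections}` is jointly continuous.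
[folklore] -/
theorem continuous_projPath_restrict (hS : S.IsSymm) (hP₀ : IsPosProjection S P₀)
    (Y : Set (V →L[ℝ] V)) (hY : ∀ P ∈ Y, IsPosProjection S P) :
    Continuous fun q : I × Y => projPath P₀ (q.2 : V →L[ℝ] V) (q.1 : ℝ) := by
  refine continuous_iff_continuousAt.2 fun q => ?_
  have hι : Continuous fun q : I × Y => ((q.1 : ℝ), (q.2 : V →L[ℝ] V)) :=
    (continuous_subtype_val.comp continuous_fst).prodMk (continuous_subtype_val.comp continuous_snd)
  have h : ContinuousAt
      ((fun r : ℝ × (V →L[ℝ] V) => projPath P₀ r.2 r.1) ∘ fun q : I × Y =>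
        ((q.1 : ℝ), (q.2 : V →L[ℝ] V))) q :=
    ContinuousAt.comp (continuousAt_projPath₂ hP₀ (hY _ q.2.2) hS q.1.2) hι.continuousAt
  exact h

/-- The values of the contracting homotopy: `(t, P) ↦ P_t(P₀, P)`, a positive projection
commuting with `C` (`isPosProjection_projPath`, `commute_projPath`). [folklore] -/
def homotopyProjPathFun (hS : S.IsSymm) (C : Set (V →L[ℝ] V)) {P₀ : V →L[ℝ] V}
    (hP₀ : P₀ ∈ {P | IsPosProjection S P ∧ ∀ c ∈ C, Commute c P})
    (q : I × {P | IsPosProjection S P ∧ ∀ c ∈ C, Commute c P}) :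
    {P | IsPosProjection S P ∧ ∀ c ∈ C, Commute c P} :=
  ⟨projPath P₀ (q.2 : V →L[ℝ] V) (q.1 : ℝ), isPosProjection_projPath hP₀.1 q.2.2.1 hS q.1.2,
    fun c hc => commute_projPath (hP₀.2 c hc) (q.2.2.2 c hc) _⟩

/-- Underlying operator of the homotopy value. [folklore] -/
theorem coe_homotopyProjPathFun (hS : S.IsSymm) (C : Set (V →L[ℝ] V)) {P₀ : V →L[ℝ] V}
    (hP₀ : P₀ ∈ {P | IsPosProjection S P ∧ ∀ c ∈ C, Commute c P})
    (q : I × {P | IsPosProjection S P ∧ ∀ c ∈ C, Commute c P}) :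
    (homotopyProjPathFun hS C hP₀ q : V →L[ℝ] V) = projPath P₀ (q.2 : V →L[ℝ] V) (q.1 : ℝ) :=
  rfl

/-- **The graph paths contract the positive projections commuting with `C` onto `P₀`**: the
homotopy `(t, P) ↦ P_t(P₀, P)` from the constant map `P₀` to the identity, through positive
projections commuting with `C`. [folklore] -/
def homotopyProjPath (hS : S.IsSymm) (C : Set (V →L[ℝ] V)) {P₀ : V →L[ℝ] V}
    (hP₀ : P₀ ∈ {P | IsPosProjection S P ∧ ∀ c ∈ C, Commute c P}) :
    ContinuousMap.Homotopy
      (ContinuousMap.const {P | IsPosProjection S P ∧ ∀ c ∈ C, Commute c P} ⟨P₀, hP₀⟩)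
      (ContinuousMap.id {P | IsPosProjection S P ∧ ∀ c ∈ C, Commute c P}) where
  toFun := homotopyProjPathFun hS C hP₀
  continuous_toFun :=
    continuous_induced_rng.2 (continuous_projPath_restrict hS hP₀.1 _ fun _ hP => hP.1)
  map_zero_left P := by
    apply Subtype.ext
    rw [coe_homotopyProjPathFun, ContinuousMap.const_apply]
    exact (congr_arg (projPath P₀ (P : V →L[ℝ] V)) Set.Icc.coe_zero).trans
      (projPath_zero hP₀.1 P.2.1 hS)
  map_one_left P := by
    apply Subtype.ext
    rw [coe_homotopyProjPathFun, ContinuousMap.id_apply]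
    exact (congr_arg (projPath P₀ (P : V →L[ℝ] V)) Set.Icc.coe_one).trans
      (projPath_one hP₀.1 P.2.1 hS)

/-- **The positive projections commuting with `C` form a contractible space** (when there is
one): with `C = ∅` the symmetric space `O(p, q)/O(p) × O(q)` of maximal positive subspaces, with
`C = {i}` (`i` a compatible complex structure) the Hermitian symmetric space
`U(p, q)/U(p) × U(q)`. [folklore] -/
theorem contractibleSpace_setOf (hS : S.IsSymm) (C : Set (V →L[ℝ] V)) {P₀ : V →L[ℝ] V}
    (hP₀ : P₀ ∈ {P | IsPosProjection S P ∧ ∀ c ∈ C, Commute c P}) :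
    ContractibleSpace {P | IsPosProjection S P ∧ ∀ c ∈ C, Commute c P} :=
  (contractible_iff_id_nullhomotopic _).2 ⟨⟨P₀, hP₀⟩, ⟨(homotopyProjPath hS C hP₀).symm⟩⟩

end Main

end IsPosProjection

/-! ### Contractibility of `X⁺` -/

section PosCx

variable {k : V →L[ℝ] V} {ψ : LinearMap.BilinForm ℝ V} {d : ℝ}

/-- `J ↦ P_J = ½ (1 - i J)` is continuous. [folklore] -/
theorem continuous_toProj (k : V →L[ℝ] V) (d : ℝ) : Continuous (toProj k d) := by
  unfold toProj
  fun_prop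

/-- **The dictionary `P ↦ J_P = i (2P - 1)` is a homeomorphism** from the positive projections of
`S = ψ (·, i ·)` commuting with `k` onto `X⁺`, with inverse `J ↦ P_J = ½ (1 - i J)`
(`ofProj_toProj`, `toProj_ofProj`, `posComplexStructures_eq_image`; both maps are affine).
[folklore] -/
def homeomorphOfProj (hd : 0 < d) (hk : k * k = -(d • (1 : V →L[ℝ] V))) (hψ : ψ.IsAlt)
    (hψk : ∀ x y, ψ (k x) y = -ψ x (k y)) :
    {P | IsPosProjection (symmForm k ψ d) P ∧ ∀ c ∈ ({k} : Set (V →L[ℝ] V)), Commute c P} ≃ₜ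
      posComplexStructures k ψ where
  toFun P := ⟨ofProj k d P, ofProj_mem_posComplexStructures hd hk hψ hψk P.2.1 (P.2.2 k rfl)⟩
  invFun J := ⟨toProj k d J, isPosProjection_toProj hd hk hψk J.2, fun c hc => by
    obtain rfl := Set.mem_singleton_iff.1 hc
    exact commute_toProj J.2.2.1⟩
  left_inv P := Subtype.ext (toProj_ofProj hd hk (P.2.2 k rfl))
  right_inv J := Subtype.ext (ofProj_toProj hd hk J)
  continuous_toFun := ((continuous_ofProj k d).comp continuous_subtype_val).subtype_mk _
  continuous_invFun := ((continuous_toProj k d).comp continuous_subtype_val).subtype_mk _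

/-- **Deligne's `X⁺` is contractible** (when non-empty, e.g. when it contains the complex
structure of a polarized abelian variety with `√-d`-multiplication): for `d > 0`, `k² = -d`, `ψ`
alternating with `ψ (k x, y) = -ψ (x, k y)`, the space of `k`-linear `ψ`-positive complex
structures is homeomorphic (`homeomorphOfProj`) to the contractible space of positive projections
of `S` commuting with `k` (`IsPosProjection.contractibleSpace_setOf`). This sharpens "`X⁺` is
connected" ([Deligne1982HodgeCycles, p. 49]; `isPathConnected_posComplexStructures`).
[cite: Deligne1982HodgeCycles, proof of Thm. 4.8, p. 49] -/
theorem contractibleSpace_posComplexStructures [FiniteDimensional ℝ V] (hd : 0 < d)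
    (hk : k * k = -(d • (1 : V →L[ℝ] V))) (hψ : ψ.IsAlt) (hψk : ∀ x y, ψ (k x) y = -ψ x (k y))
    (hne : (posComplexStructures k ψ).Nonempty) : ContractibleSpace (posComplexStructures k ψ) := by
  obtain ⟨J₀, hJ₀⟩ := hne
  have hS := isSymm_symmForm hψ hψk d
  have hP₀ : toProj k d J₀ ∈ {P | IsPosProjection (symmForm k ψ d) P ∧
      ∀ c ∈ ({k} : Set (V →L[ℝ] V)), Commute c P} :=
    ⟨isPosProjection_toProj hd hk hψk hJ₀, fun c hc => by
      obtain rfl := Set.mem_singleton_iff.1 hc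
      exact commute_toProj hJ₀.2.1⟩
  haveI := IsPosProjection.contractibleSpace_setOf hS ({k} : Set (V →L[ℝ] V)) hP₀
  exact (homeomorphOfProj hd hk hψ hψk).symm.contractibleSpace

/-- **`X⁺` is simply connected** (contractible), so that for a torsion-free arithmetic group `Γ`
the covering map `X⁺ → Γ\X⁺` (`QuadraticForm/PosComplexStructuresArithmeticQuotient`) is a
universal cover of the base of Deligne's family ([Deligne1982HodgeCycles, p. 50]). [folklore] -/
theorem simplyConnectedSpace_posComplexStructures [FiniteDimensional ℝ V] (hd : 0 < d)
    (hk : k * k = -(d • (1 : V →L[ℝ] V))) (hψ : ψ.IsAlt) (hψk : ∀ x y, ψ (k x) y = -ψ x (k y))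
    (hne : (posComplexStructures k ψ).Nonempty) :
    SimplyConnectedSpace (posComplexStructures k ψ) := by
  haveI := contractibleSpace_posComplexStructures hd hk hψ hψk hne
  infer_instance

end PosCx

end Literature.LinearAlgebra.QuadraticForm
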